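import Literature.AlgebraicGeometry.PlaneCurves.HessePencilCharacteristicThreeTranslation
import Literature.AlgebraicGeometry.PlaneCurves.PlaneCubicTranslationPrinciple
import HarnessLib

/-!
# The negation for the zero `(1, −1, 0)` in characteristic `3` is `(x, y, z) ↦ (y, x, z)` (Artebani–Dolgachev §2, Remark 5.5)

Topic `Literature/AlgebraicGeometry/PlaneCurves`, namespace `Literature.AlgebraicGeometry.PlaneCurves`.
Lane `lit-hodgefound`, seat `lit-hodgefound-p37`, row g21-#6: the first INSTANCE of the generic
`PlaneCubicTranslationPrinciple` (g21-#5, `negation_principle_of_model`), for the characteristic-`3`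
model of `HessePencilCharacteristicThreeWeierstrass` (g21-#3: `E_t ∘ M_t = −W₃[t]`, zero
`M_t(0,1,0) = t⁻¹·(1, −1, 0)`), completing `HessePencilCharacteristicThreeTranslation` (g21-#4: `g₁` is
`P ↦ P + T`) by the inversion of the same group law.  Everything here is PROVED; no definition, no
named fact.

Source — M. Artebani, I. Dolgachev, *The Hesse pencil of plane cubic curves*, Enseign. Math. (2) 55
(2009), §2 [`paper:arxiv-math_0611590` p0004 L5–6], VERBATIM: "Fixing one of the inflection points `p₀`
defines a commutative group law `⊕` on `E` with `p₀` equal to the zero: `p ⊕ q` is the unique point `r`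
such that `p₀, r` and the third point of intersection in `p̄q̄ ∩ E` lie on a line."; §5, Remark 5.5:
"… with the zero point taken to be `(1, −1, 0)`."  With the zero `o = (1, −1, 0)` the negative of
`q = (a, b, c) ∈ E_t` is the third point of the line `ōq̄`, namely `νq = (b, a, c)`:
`det[o; q; νq] = 0` identically and `E_t(νq) = E_t(q)`.

## What is here

* §1 `hesseE_isHomogeneous` (`E_t` is a ternary cubic form), `hesseE_model_charThree`
  (`E_t ∘ M_t = (−1)·W₃[t]` in the shape `PlaneCubicTranslationPrinciple` consumes).
* §2 `mulVec_ν_facts` (`νp = (p₁, p₀, p₂)`, `E_t ∘ ν = E_t` pointwise, `ν² = 1`, `det ν = −1`,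
  `ν(M_t(0,1,0)) = −M_t(0,1,0)`), `det_o_p_ν` (`det[M_t(0,1,0); p; νp] = 0`),
  `hesseE_grad_dotProduct_zero_of_ν` (the coincident case `νp ∥ p` is a tangency).
* §3 **`hesseE_neg_iff_of_three_eq_zero`**: for `3 = 0`, `t ≠ 0` and all `P, Q ∈ W₃[t](K)`:
  `M vec Q ∥ ν(M vec P)` iff `Q = −P` — the negation for the zero `(1, −1, 0)` is `(x, y, z) ↦ (y, x, z)`.

## References
* [ArtebaniDolgachev2009] M. Artebani, I. Dolgachev, *The Hesse pencil of plane cubic curves*,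
  Enseign. Math. (2) 55 (2009) 235–273, §2 (the group law), §5 Remark 5.5.
* [Kunz2005PlaneAlgebraicCurves] E. Kunz, *Introduction to Plane Algebraic Curves*, Birkhäuser 2005,
  Ch. 10, Cor. 10.7.
-/

set_option autoImplicit false

open MvPolynomial Matrix
open Literature.AlgebraicGeometry.HyperbolicPolynomials

namespace Literature.AlgebraicGeometry.PlaneCurves

universe u

/-- The member `E_t = X³ + Y³ + Z³ + t·XYZ` (local notation, no definition). -/
local notation3 "𝐄[" t "]" =>
  (X 0 ^ 3 + X 1 ^ 3 + X 2 ^ 3 + C t * (X 0 * X 1 * X 2) : MvPolynomial (Fin 3) _)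

/-- `M_t = [[0, t⁻¹, 0], [1, −t⁻¹, 0], [0, 0, t]]` (g21-#3; local notation). -/
local notation3 "𝐌[" t "]" =>
  (Matrix.of ![![(0 : _), t⁻¹, 0], ![1, -t⁻¹, 0], ![0, 0, t]] : Matrix (Fin 3) (Fin 3) _)

/-- `W₃[t] = ⟨−t, 0, 0, 0, t³⟩` (g21-#3; local notation). -/
local notation3 "𝐖₃[" t "]" =>
  ({ a₁ := -t, a₂ := 0, a₃ := 0, a₄ := 0, a₆ := t ^ 3 } : WeierstrassCurve _)

/-- `ν = (y, x, z)` (local notation, no definition). -/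
local notation3 "𝛎" => (Matrix.of ![![(0 : _), 1, 0], ![1, 0, 0], ![0, 0, 1]] : Matrix (Fin 3) (Fin 3) _)

section CharThreeNegation

variable {K : Type u} [Field K]

/-! ## §1 `E_t` as a model in the sense of `PlaneCubicTranslationPrinciple` -/

/-- `E_t` is a ternary cubic form. [cite: ArtebaniDolgachev2009, §1 (plane cubic curves)] -/
theorem hesseE_isHomogeneous (t : K) : (𝐄[t] : MvPolynomial (Fin 3) K).IsHomogeneous 3 := by
  refine ((((isHomogeneous_X K 0).pow 3).add ((isHomogeneous_X K 1).pow 3)).add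
    ((isHomogeneous_X K 2).pow 3)).add ?_
  have h := ((isHomogeneous_C (Fin 3) t).mul
    (((isHomogeneous_X K 0).mul (isHomogeneous_X K 1)).mul (isHomogeneous_X K 2)))
  simpa using h

/-- `E_t ∘ M_t = (−1) · W₃[t]` (`3 = 0`, `t ≠ 0`; g21-#3 `hesseE_bind₁_charThree`).
[cite: ArtebaniDolgachev2009, §5, Remark 5.5] -/
theorem hesseE_model_charThree (h3 : (3 : K) = 0) {t : K} (ht : t ≠ 0) :
    bind₁ (𝐌[t] : Matrix (Fin 3) (Fin 3) K).toMvPolynomial 𝐄[t] =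
      (-1 : K) • (𝐖₃[t] : WeierstrassCurve K).toProjective.polynomial := by
  rw [hesseE_bind₁_charThree h3 ht, neg_one_smul]

/-! ## §2 The substitution `ν = (y, x, z)` -/

/-- `νp = (p₁, p₀, p₂)`; `E_t(νp) = E_t(p)`; `ν² = 1`; `det ν = −1`; `ν` negates the zero vector
`M_t(0, 1, 0) = (t⁻¹, −t⁻¹, 0)`. [cite: ArtebaniDolgachev2009, §5, Remark 5.5 (zero point `(1, −1, 0)`)] -/
theorem mulVec_ν_facts (t : K) :
    (∀ p : Fin 3 → K, (𝛎 : Matrix (Fin 3) (Fin 3) K) *ᵥ p = ![p 1, p 0, p 2]) ∧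
      (∀ p : Fin 3 → K, eval ((𝛎 : Matrix (Fin 3) (Fin 3) K) *ᵥ p) 𝐄[t] = eval p 𝐄[t]) ∧
      (𝛎 : Matrix (Fin 3) (Fin 3) K) * 𝛎 = 1 ∧ (𝛎 : Matrix (Fin 3) (Fin 3) K).det = -1 ∧
      (𝛎 : Matrix (Fin 3) (Fin 3) K) *ᵥ ((𝐌[t] : Matrix (Fin 3) (Fin 3) K) *ᵥ ![0, 1, 0]) =
        (-1 : K) • ((𝐌[t] : Matrix (Fin 3) (Fin 3) K) *ᵥ ![0, 1, 0]) := by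
  have h1 : ∀ p : Fin 3 → K, (𝛎 : Matrix (Fin 3) (Fin 3) K) *ᵥ p = ![p 1, p 0, p 2] := fun p => by
    funext i; fin_cases i <;> simp [Matrix.mulVec, dotProduct, Fin.sum_univ_three]
  refine ⟨h1, fun p => ?_, ?_, ?_, ?_⟩
  · rw [h1, hesseE_eval, hesseE_eval]; simp; ring
  · ext i j : 1
    fin_cases i <;> fin_cases j <;> simp [Matrix.mul_apply, Fin.sum_univ_three]
  · rw [Matrix.det_fin_three]; simp
  · rw [charThree_matrix_mulVec_O, h1]
    funext i; fin_cases i <;> simp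

/-- **`o, p, νp` are collinear**: `det[M_t(0,1,0); p; νp] = 0` identically — `νp` is the third point of
the line through the zero and `p`. [cite: ArtebaniDolgachev2009, §2 (the group law with zero a flex)] -/
theorem det_o_p_ν (t : K) (p : Fin 3 → K) :
    (Matrix.of ![(𝐌[t] : Matrix (Fin 3) (Fin 3) K) *ᵥ ![0, 1, 0], p,
      (𝛎 : Matrix (Fin 3) (Fin 3) K) *ᵥ p]).det = 0 := by
  rw [charThree_matrix_mulVec_O, (mulVec_ν_facts t).1, Matrix.det_fin_three]
  simp
  ring

/-- **The coincident case `νp ∥ p` is a tangency** (`3 = 0`): `⟨∇E_t(p), M_t(0,1,0)⟩ = p₂·(p₁ − p₀)`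
up to the unit `t⁻¹·t`, and `νp = a·p` forces `p₂ = 0` or `p₀ = p₁`. [cite: ArtebaniDolgachev2009,
§2 (the group law); §5, Remark 5.5] -/
theorem hesseE_grad_dotProduct_zero_of_ν (h3 : (3 : K) = 0) (t : K) (p : Fin 3 → K) (a : K)
    (ha : (𝛎 : Matrix (Fin 3) (Fin 3) K) *ᵥ p = a • p) :
    (fun i => eval p (pderiv i 𝐄[t])) ⬝ᵥ ((𝐌[t] : Matrix (Fin 3) (Fin 3) K) *ᵥ ![0, 1, 0]) = 0 := by
  rw [charThree_matrix_mulVec_O, dotProduct_smul, (hesseE_grad_dotProduct_o_of_three_eq_zero h3 t p).1,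
    smul_eq_mul]
  rw [(mulVec_ν_facts t).1] at ha
  have e0 : p 1 = a * p 0 := by simpa using congrFun ha 0
  have e2 : p 2 = a * p 2 := by simpa using congrFun ha 2
  by_cases hp2 : p 2 = 0
  · rw [hp2]; ring
  · have ha1 : a = 1 := by
      have : (a - 1) * p 2 = 0 := by linear_combination -e2
      exact sub_eq_zero.1 ((mul_eq_zero.1 this).resolve_right hp2)
    rw [ha1, one_mul] at e0
    rw [e0]; ring

/-! ## §3 `ν` is the negation -/

variable {t : K} (vec : (𝐖₃[t] : WeierstrassCurve K).toAffine.Point → Fin 3 → K)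

/-- **The negation for the zero `(1, −1, 0)` is `(x, y, z) ↦ (y, x, z)`.**  For `3 = 0`, `t ≠ 0` and
all `P, Q ∈ W₃[t](K)`: the Hesse point `M vec Q` is `ν(M vec P) = (y, x, z)` up to a non-zero scalar
iff `Q = −P` (`PlaneCubicTranslationPrinciple.negation_principle_of_model` for the model
`E_t ∘ M_t = −W₃[t]`, the line `det[o; p; νp] = 0`). [cite: ArtebaniDolgachev2009, §2 (the group law
with zero a flex); §5, Remark 5.5 (zero point `(1, −1, 0)`)] [cite: Kunz2005PlaneAlgebraicCurves,
Ch. 10, Cor. 10.7] -/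
theorem hesseE_neg_iff_of_three_eq_zero [DecidableEq K] (h3 : (3 : K) = 0) (ht : t ≠ 0)
    (hv0 : vec 0 = ![0, 1, 0])
    (hvs : ∀ x y (h : (𝐖₃[t] : WeierstrassCurve K).toAffine.Nonsingular x y), vec (.some x y h) = ![x, y, 1])
    (P Q : (𝐖₃[t] : WeierstrassCurve K).toAffine.Point) :
    (∃ a : K, a ≠ 0 ∧ (𝛎 : Matrix (Fin 3) (Fin 3) K) *ᵥ ((𝐌[t] : Matrix (Fin 3) (Fin 3) K) *ᵥ vec P) =
        a • ((𝐌[t] : Matrix (Fin 3) (Fin 3) K) *ᵥ vec Q)) ↔ Q = -P := by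
  haveI : (𝐖₃[t] : WeierstrassCurve K).IsElliptic := (charThree_weierstrass_isElliptic_iff h3 t).2 ht
  obtain ⟨hν, hνE, hνν, hνdet, hνo⟩ := mulVec_ν_facts (K := K) t
  have hM : (𝐌[t] : Matrix (Fin 3) (Fin 3) K).det ≠ 0 := by rw [charThree_matrix_det ht]; norm_num
  refine negation_principle_of_model vec (hesseE_model_charThree h3 ht) (by norm_num) hM hv0 hvs hνE
    (by rw [hνdet]; norm_num) ⟨-1, hνo⟩ (det_o_p_ν t) (fun p _ _ a ha => ?_) (fun p a _ ha => ?_) P Q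
  · exact Or.inl (hesseE_grad_dotProduct_zero_of_ν h3 t p a ha)
  · refine ⟨-a, ?_⟩
    have e : p = (𝛎 : Matrix (Fin 3) (Fin 3) K) *ᵥ ((𝛎 : Matrix (Fin 3) (Fin 3) K) *ᵥ p) := by
      rw [Matrix.mulVec_mulVec, hνν, Matrix.one_mulVec]
    rw [e, ha, Matrix.mulVec_smul, hνo, smul_smul, mul_neg_one]

end CharThreeNegation

end Literature.AlgebraicGeometry.PlaneCurves
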